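import Summits.KontsevichZagierPeriods.KontsevichZagierPeriods.Theses.ZeroPortrait
import Summits.KontsevichZagierPeriods.KontsevichZagierPeriods.Theses.LiftingCriteria
import Summits.KontsevichZagierPeriods.KontsevichZagierPeriods.Theorems.LiftingCriteriaCubeNashNormalFormDimLeOne

/-!
# Birth skeleton (BC3) of leaf 1 `CubeNashNormalForm` of the Ayoub–π split of
`ZeroPortrait.PencilComplete` (stmt-KontsevichZagierPeriods-11731)

Leaf 1 IS the existing shared item stmt-KontsevichZagierPeriods-3574 (`LiftingCriteria.CubeNashNormalForm`,
also DimensionBudget / SymplecticScissors), byte-equal signature, so the split child dedups to it. Its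
PLAN already exists in the tree: the registered skeleton `Cruxes/BudgetThesis/Lines/tame_cell_atlas.lean`
(planner-cstrat-3748-r1, 2026-08-17; stubs `stub_tameCellAtlas`, `stub_atlasToNormalForm`) over the
LANDED reduction `LiftingCriteria.CubeNashNormalFormDimLeOne.cubeNashNormalForm_of_volume_three`
(dimensions `≤ 2` are in the tree; what remains is the normal form of bounded volumes `∫_S 1`,
`S ⊆ ℝ^{m+3}`). This file re-checks that skeleton against the ZeroPortrait child (definitionally the
LiftingCriteria decl): the two stubs VERBATIM and the composition concluding the leaf.

* `stub_tameCellAtlas` — real algebraic geometry (hardest, XL): tame cell atlas of a bounded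
  `ℚ`-semialgebraic set (rectilinearisation: Hironaka 1973; Bierstone–Milman 1988 §4; BCR §9).
* `stub_atlasToNormalForm` — calculus bookkeeping (M): atlas ⇒ cube–Nash normal form by one
  change-of-variables move per chart, domain additivity, null remainders.
-/

-- single-conjunct summit: Sub = Summit (CONVENTIONS §2)
set_option linter.dupNamespace false

open Set MeasureTheory
open Literature.ModelTheory.ExponentialFields (IsSemialgebraic)
open Literature.NumberTheory.Transcendental
open Literature.NumberTheory.Transcendental.KZ

namespace Summit.KontsevichZagierPeriods.KontsevichZagierPeriods.Cruxes.CubeNashNormalForm.BirthZeroPortrait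

/-- **Leaf 1** of the split, verbatim as filed (= item stmt-KontsevichZagierPeriods-3574).
[cite: Ayoub2014, Rem. 12] [cite: HuberMullerStachPeriods2017, Lemma 11.2.3] -/
def CubeNashNormalForm : Prop :=
  ∀ (k k' : ℕ) (r : Literature.NumberTheory.Transcendental.KZ.IntegralRep k) (r' : Literature.NumberTheory.Transcendental.KZ.IntegralRep k'), r.IsRational → r'.IsRational → ∃ (S : ℕ) (n : Fin S → ℕ) (g : (i : Fin S) → (Fin (n i) → ℝ) → ℝ) (U : (i : Fin S) → Set (Fin (n i) → ℝ)) (ε : Fin S → ℤ) (s : (i : Fin S) → Literature.NumberTheory.Transcendental.KZ.IntegralRep (n i)), (∀ i, IsOpen (U i) ∧ Set.pi Set.univ (fun _ : Fin (n i) => Set.Icc (0:ℝ) 1) ⊆ (U i) ∧ Literature.NumberTheory.Transcendental.IsSemialgebraicFunOn ℚ (U i) (g i) ∧ AnalyticOnNhd ℝ (g i) (U i)) ∧ (∀ i, (s i).domain = Set.pi Set.univ (fun _ : Fin (n i) => Set.Icc (0:ℝ) 1) ∧ ∀ z ∈ Set.pi Set.univ (fun _ : Fin (n i) => Set.Icc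 (0:ℝ) 1), (s i).integrand z = g i z) ∧ Literature.NumberTheory.Transcendental.KZ.of r - Literature.NumberTheory.Transcendental.KZ.of r' - ∑ i, ε i • Literature.NumberTheory.Transcendental.KZ.of (s i) ∈ Literature.NumberTheory.Transcendental.KZ.relations

/-- Leaf 1 is the LiftingCriteria decl of item 3574 on the nose. [folklore] -/
theorem leaf_iff :
    CubeNashNormalForm ↔ Summit.KontsevichZagierPeriods.KontsevichZagierPeriods.Theses.LiftingCriteria.CubeNashNormalForm :=
  Iff.rfl

/-! ## The two stubs (verbatim from the registered skeleton of item 3574; sorries live only here) -/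

/-- **S1 `stub_tameCellAtlas`** (rectilinearisation of bounded semialgebraic sets; hardest, XL).
[Hironaka 1973; Bierstone–Milman 1988, §4; Bochnak–Coste–Roy 1998, §9] -/
theorem stub_tameCellAtlas :
    ∀ (m : ℕ) (S : Set (Fin (m + 3) → ℝ)), Literature.ModelTheory.ExponentialFields.IsSemialgebraic ℚ S → Bornology.IsBounded S → ∃ (N : ℕ) (Φ : Fin N → (Fin (m + 3) → ℝ) → (Fin (m + 3) → ℝ)) (Φ' : Fin N → (Fin (m + 3) → ℝ) → ((Fin (m + 3) → ℝ) →L[ℝ] (Fin (m + 3) → ℝ))) (g : Fin N → (Fin (m + 3) → ℝ) → ℝ) (U : Fin N → Set (Fin (m + 3) → ℝ)), (∀ i, Literature.NumberTheory.Transcendental.IsSemialgebraicMapOn ℚ {z : Fin (m + 3) → ℝ | ∀ l, 0 < z l ∧ z l < 1} (Φ i) ∧ (∀ x ∈ {z : Fin (m + 3) → ℝ | ∀ l, 0 < z l ∧ z l < 1}, HasFDerivWithinAt (Φ i) (Φ' i x) {z : Fin (m + 3) → ℝ | ∀ l, 0 < z l ∧ z l < 1} x) ∧ Set.InjOn (Φ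 i) {z : Fin (m + 3) → ℝ | ∀ l, 0 < z l ∧ z l < 1} ∧ Φ i '' {z : Fin (m + 3) → ℝ | ∀ l, 0 < z l ∧ z l < 1} ⊆ S ∧ IsOpen (U i) ∧ Set.pi Set.univ (fun _ : Fin (m + 3) => Set.Icc (0:ℝ) 1) ⊆ U i ∧ Literature.NumberTheory.Transcendental.IsSemialgebraicFunOn ℚ (U i) (g i) ∧ AnalyticOnNhd ℝ (g i) (U i) ∧ (∀ x ∈ {z : Fin (m + 3) → ℝ | ∀ l, 0 < z l ∧ z l < 1}, |(Φ' i x).det| = g i x)) ∧ (∀ i j, i ≠ j → Disjoint (Φ i '' {z : Fin (m + 3) → ℝ | ∀ l, 0 < z l ∧ z l < 1}) (Φ j '' {z : Fin (m + 3) → ℝ | ∀ l, 0 < z l ∧ z l < 1})) ∧ MeasureTheory.volume (S \ ⋃ i, Φ i '' {z : Fin (m + 3) → ℝ | ∀ l, 0 < z l ∧ z l < 1}) = 0 := by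
  sorry

/-- **S2 `stub_atlasToNormalForm`** (atlas ⇒ cube–Nash normal form of a bounded volume; size M).
[Kontsevich–Zagier 2001, §1.2 rules (1), (2)] -/
theorem stub_atlasToNormalForm :
    ∀ (m : ℕ) (K : Literature.NumberTheory.Transcendental.KZ.IntegralRep (m + 3)), Bornology.IsBounded K.domain → (∀ x ∈ K.domain, K.integrand x = 1) → ∀ (N : ℕ) (Φ : Fin N → (Fin (m + 3) → ℝ) → (Fin (m + 3) → ℝ)) (Φ' : Fin N → (Fin (m + 3) → ℝ) → ((Fin (m + 3) → ℝ) →L[ℝ] (Fin (m + 3) → ℝ))) (g : Fin N → (Fin (m + 3) → ℝ) → ℝ) (U : Fin N → Set (Fin (m + 3) → ℝ)), (∀ i, Literature.NumberTheory.Transcendental.IsSemialgebraicMapOn ℚ {z : Fin (m + 3) → ℝ | ∀ l, 0 < z l ∧ z l < 1} (Φ i) ∧ (∀ x ∈ {z : Fin (m + 3) → ℝ | ∀ l, 0 < z l ∧ z l < 1}, HasFDerivWithinAt (Φ i) (Φ' i x) {z : Fin (m + 3) → ℝ | ∀ l, 0 < z l ∧ z l < 1} x) ∧ Set.InjOn (Φ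 i) {z : Fin (m + 3) → ℝ | ∀ l, 0 < z l ∧ z l < 1} ∧ Φ i '' {z : Fin (m + 3) → ℝ | ∀ l, 0 < z l ∧ z l < 1} ⊆ K.domain ∧ IsOpen (U i) ∧ Set.pi Set.univ (fun _ : Fin (m + 3) => Set.Icc (0:ℝ) 1) ⊆ U i ∧ Literature.NumberTheory.Transcendental.IsSemialgebraicFunOn ℚ (U i) (g i) ∧ AnalyticOnNhd ℝ (g i) (U i) ∧ (∀ x ∈ {z : Fin (m + 3) → ℝ | ∀ l, 0 < z l ∧ z l < 1}, |(Φ' i x).det| = g i x)) → (∀ i j, i ≠ j → Disjoint (Φ i '' {z : Fin (m + 3) → ℝ | ∀ l, 0 < z l ∧ z l < 1}) (Φ j '' {z : Fin (m + 3) → ℝ | ∀ l, 0 < z l ∧ z l < 1})) → MeasureTheory.volume (K.domain \ ⋃ i, Φ i '' {z : Fin (m + 3) → ℝ | ∀ l, 0 < z l ∧ z l < 1}) = 0 → ∃ (S : ℕ) (n : Fin S → ℕ) (g' : (i : Fin S) → (Fin (n i) → ℝ) → ℝ) (U' : (i : Fin S) → Set (Fin (n i) → ℝ)) (ε : Fin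 S → ℤ) (s : (i : Fin S) → Literature.NumberTheory.Transcendental.KZ.IntegralRep (n i)), (∀ i, IsOpen (U' i) ∧ Set.pi Set.univ (fun _ : Fin (n i) => Set.Icc (0:ℝ) 1) ⊆ (U' i) ∧ Literature.NumberTheory.Transcendental.IsSemialgebraicFunOn ℚ (U' i) (g' i) ∧ AnalyticOnNhd ℝ (g' i) (U' i)) ∧ (∀ i, (s i).domain = Set.pi Set.univ (fun _ : Fin (n i) => Set.Icc (0:ℝ) 1) ∧ ∀ z ∈ Set.pi Set.univ (fun _ : Fin (n i) => Set.Icc (0:ℝ) 1), (s i).integrand z = g' i z) ∧ Literature.NumberTheory.Transcendental.KZ.of K - ∑ i, ε i • Literature.NumberTheory.Transcendental.KZ.of (s i) ∈ Literature.NumberTheory.Transcendental.KZ.relations := by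
  sorry

/-- **Composition**: the two stubs discharge the hypothesis of the landed reduction
`cubeNashNormalForm_of_volume_three`, giving leaf 1 (definitionally `LiftingCriteria.CubeNashNormalForm`).
[Kontsevich–Zagier 2001, §1.2; Viu-Sos 2021, Thm. 1.1] -/
theorem CubeNashNormalForm_of :
    (∀ (m : ℕ) (S : Set (Fin (m + 3) → ℝ)), Literature.ModelTheory.ExponentialFields.IsSemialgebraic ℚ S → Bornology.IsBounded S → ∃ (N : ℕ) (Φ : Fin N → (Fin (m + 3) → ℝ) → (Fin (m + 3) → ℝ)) (Φ' : Fin N → (Fin (m + 3) → ℝ) → ((Fin (m + 3) → ℝ) →L[ℝ] (Fin (m + 3) → ℝ))) (g : Fin N → (Fin (m + 3) → ℝ) → ℝ) (U : Fin N → Set (Fin (m + 3) → ℝ)), (∀ i, Literature.NumberTheory.Transcendental.IsSemialgebraicMapOn ℚ {z : Fin (m + 3) → ℝ | ∀ l, 0 < z l ∧ z l < 1} (Φ i) ∧ (∀ x ∈ {z : Fin (m + 3) → ℝ | ∀ l, 0 < z l ∧ z l < 1}, HasFDerivWithinAt (Φ i) (Φ' i x) {z : Fin (m + 3) → ℝ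 | ∀ l, 0 < z l ∧ z l < 1} x) ∧ Set.InjOn (Φ i) {z : Fin (m + 3) → ℝ | ∀ l, 0 < z l ∧ z l < 1} ∧ Φ i '' {z : Fin (m + 3) → ℝ | ∀ l, 0 < z l ∧ z l < 1} ⊆ S ∧ IsOpen (U i) ∧ Set.pi Set.univ (fun _ : Fin (m + 3) => Set.Icc (0:ℝ) 1) ⊆ U i ∧ Literature.NumberTheory.Transcendental.IsSemialgebraicFunOn ℚ (U i) (g i) ∧ AnalyticOnNhd ℝ (g i) (U i) ∧ (∀ x ∈ {z : Fin (m + 3) → ℝ | ∀ l, 0 < z l ∧ z l < 1}, |(Φ' i x).det| = g i x)) ∧ (∀ i j, i ≠ j → Disjoint (Φ i '' {z : Fin (m + 3) → ℝ | ∀ l, 0 < z l ∧ z l < 1}) (Φ j '' {z : Fin (m + 3) → ℝ | ∀ l, 0 < z l ∧ z l < 1})) ∧ MeasureTheory.volume (S \ ⋃ i, Φ i '' {z : Fin (m + 3) → ℝ | ∀ l, 0 < z l ∧ z l < 1}) = 0) →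
    (∀ (m : ℕ) (K : Literature.NumberTheory.Transcendental.KZ.IntegralRep (m + 3)), Bornology.IsBounded K.domain → (∀ x ∈ K.domain, K.integrand x = 1) → ∀ (N : ℕ) (Φ : Fin N → (Fin (m + 3) → ℝ) → (Fin (m + 3) → ℝ)) (Φ' : Fin N → (Fin (m + 3) → ℝ) → ((Fin (m + 3) → ℝ) →L[ℝ] (Fin (m + 3) → ℝ))) (g : Fin N → (Fin (m + 3) → ℝ) → ℝ) (U : Fin N → Set (Fin (m + 3) → ℝ)), (∀ i, Literature.NumberTheory.Transcendental.IsSemialgebraicMapOn ℚ {z : Fin (m + 3) → ℝ | ∀ l, 0 < z l ∧ z l < 1} (Φ i) ∧ (∀ x ∈ {z : Fin (m + 3) → ℝ | ∀ l, 0 < z l ∧ z l < 1}, HasFDerivWithinAt (Φ i) (Φ' i x) {z : Fin (m + 3) → ℝ | ∀ l, 0 < z l ∧ z l < 1} x) ∧ Set.InjOn (Φ i) {z : Fin (m + 3) → ℝ | ∀ l, 0 < z l ∧ z l < 1} ∧ Φ i '' {z : Fin (m + 3) → ℝ | ∀ l, 0 < z l ∧ z l < 1} ⊆ K.domain ∧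 IsOpen (U i) ∧ Set.pi Set.univ (fun _ : Fin (m + 3) => Set.Icc (0:ℝ) 1) ⊆ U i ∧ Literature.NumberTheory.Transcendental.IsSemialgebraicFunOn ℚ (U i) (g i) ∧ AnalyticOnNhd ℝ (g i) (U i) ∧ (∀ x ∈ {z : Fin (m + 3) → ℝ | ∀ l, 0 < z l ∧ z l < 1}, |(Φ' i x).det| = g i x)) → (∀ i j, i ≠ j → Disjoint (Φ i '' {z : Fin (m + 3) → ℝ | ∀ l, 0 < z l ∧ z l < 1}) (Φ j '' {z : Fin (m + 3) → ℝ | ∀ l, 0 < z l ∧ z l < 1})) → MeasureTheory.volume (K.domain \ ⋃ i, Φ i '' {z : Fin (m + 3) → ℝ | ∀ l, 0 < z l ∧ z l < 1}) = 0 → ∃ (S : ℕ) (n : Fin S → ℕ) (g' : (i : Fin S) → (Fin (n i) → ℝ) → ℝ) (U' : (i : Fin S) → Set (Fin (n i) → ℝ)) (ε : Fin S → ℤ) (s : (i : Fin S) → Literature.NumberTheory.Transcendental.KZ.IntegralRep (n i)), (∀ i, IsOpen (U' i) ∧ Set.pi Set.univ (fun _ : Fin (n i) => Set.Icc (0:ℝ)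 1) ⊆ (U' i) ∧ Literature.NumberTheory.Transcendental.IsSemialgebraicFunOn ℚ (U' i) (g' i) ∧ AnalyticOnNhd ℝ (g' i) (U' i)) ∧ (∀ i, (s i).domain = Set.pi Set.univ (fun _ : Fin (n i) => Set.Icc (0:ℝ) 1) ∧ ∀ z ∈ Set.pi Set.univ (fun _ : Fin (n i) => Set.Icc (0:ℝ) 1), (s i).integrand z = g' i z) ∧ Literature.NumberTheory.Transcendental.KZ.of K - ∑ i, ε i • Literature.NumberTheory.Transcendental.KZ.of (s i) ∈ Literature.NumberTheory.Transcendental.KZ.relations) →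
      CubeNashNormalForm := by
  intro h1 h2
  rw [leaf_iff]
  refine Summit.KontsevichZagierPeriods.LiftingCriteria.CubeNashNormalFormDimLeOne.cubeNashNormalForm_of_volume_three
    fun m K hb hK1 => ?_
  obtain ⟨N, Φ, Φ', g, U, hcharts, hdisj, hnull⟩ := h1 m K.domain K.isSemialgebraic_domain hb
  exact h2 m K hb hK1 N Φ Φ' g U hcharts hdisj hnull

/-- Leaf 1 from the registered stubs. [folklore] -/
theorem cubeNashNormalForm_of_stubs : CubeNashNormalForm :=
  CubeNashNormalForm_of stub_tameCellAtlas stub_atlasToNormalForm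

end Summit.KontsevichZagierPeriods.KontsevichZagierPeriods.Cruxes.CubeNashNormalForm.BirthZeroPortrait
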